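import Summits.HodgeConjecture.Statement
import Summits.HodgeConjecture.HodgeConjecture.Theses.RankFourFaces
import Summits.HodgeConjecture.HodgeConjecture.Theses.PadicSemiregularLift
import Summits.HodgeConjecture.HodgeConjecture.Theorems.WeilTypeLadder
import Summits.HodgeConjecture.HodgeConjecture.Theorems.WeilTypeLadderCMReduction
import Summits.HodgeConjecture.HodgeConjecture.Theorems.Ring2DeformVariationalInputs
import Literature.AlgebraicGeometry.HodgeTheory.WeilTypeAbelianVariety
import Literature.AlgebraicGeometry.HodgeTheory.LefschetzOneOneHolds
import Literature.AlgebraicGeometry.HodgeTheory.AbelianLowDimensionHodgeConjecture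
import Literature.AlgebraicGeometry.HodgeTheory.ComplexConjugationHolds
import HarnessLib

/-!
# Ring 2 · statement layer (typer1) — the Weil-type class targets, their joints with the Weil-type ladder, and the base cases

HONEST FRAMING: research route conditional on HC_CM; not a corollary; Q11.4-sentence-2 already refuted in dim ≥ 3.

Cell `pub-hodge-ring2`, seat `pub-hodge-ring2-typer1` (statement layer + lead). `HC_CM` is ALWAYS the explicit
hypothesis `Theses.RankFourFaces.CMAbelianHodge` (tree item stmt-HodgeConjecture-3052; `= ∀ A,
Milne1999.CMHodgeHypothesisAt A` by `Iff.rfl`) — a binder, never an axiom, never "known"; `HC_AV` is the tree item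
`Theses.PadicSemiregularLift.HodgeAbelianVarieties` (stmt-HodgeConjecture-1333); `HC_AV_of_HC_CM` is (up to the
dischargeable smooth-projectivity guard) the open route crux `Theses.RankFourFaces.CMToAbelian`
(stmt-HodgeConjecture-16267) and is NOT re-filed. No internally-minted statement (PerL / QW8 / the 2001
programme) is cited anywhere. Sorry-free; NO new `def`: the class targets are INLINED as local notations whose
bodies are verbatim the `@[conjecture]` definitions of the cell's staged statement layer
`Summits/HodgeConjecture/Ring2/{Defs,OnPath,BaseCases}.lean` (namespace `Summit.HodgeConjecture.Ring2`; staged in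
the cell HOME because the gate does not allowlist the `Ring2` topic for this role, 2026-08-19) over the LANDED
Literature definitions `IsWeilType` / `WeilType` / `IsSplitWeilType` / `IsNonsplitWeilType`
(`Literature/AlgebraicGeometry/HodgeTheory/WeilTypeAbelianVariety.lean`, p184783).

## The objects (Literature, landed)

`IsWeilType A φ n d` — van Geemen's Definition 4.9 on the tree's real carriers: `dim A = 2n`, `φ ∈ End(A)` with
`φ ∘ φ = -d` (so `K = ℚ(φ) ≅ ℚ(√-d)` imaginary quadratic acts), and `φ^*` has the eigenvalues `+i√d` and `-i√d`
with the SAME multiplicity `n` on `H^{1,0}(A)`; kernel-equivalent (`isWeilType_iff_weilPlane`) to "the Weil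
plane `weilClassesOf A φ n d = ⋀_K^{2n} H¹(A,ℚ) ⊂ H^{2n}(A,ℚ)` consists of Hodge classes of type `(n,n)`"
(van Geemen Lemma 5.2(3) + Prop. 5.3 / Deligne 1982 Prop. 4.4). `IsSplitWeilType` / `IsNonsplitWeilType`: the
discriminant invariant `δ ∈ ℚ^×/Nm(K^×)` (van Geemen 5.2(2)) is typed on the carriers only through its
split / non-split dichotomy (Markman's `IsHyperbolicWeilType`: an isotropic vector for the K-Hermitian form).

## The map (kernel content of this file)

* (T) CLASS TARGETS (local notations): `HC_WeilType[]` (HC for every abelian variety of Weil type, all `(K, n)`),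
  `HC_WeilTypeAt[n, d]` (fixed signature `(n,n)` and `K = ℚ(√-d)`), `HC_SplitWeilTypeAt[n, d]`,
  `HC_NonsplitWeilTypeAt[n, d]`, `HC_SplitWeilType[]`, `HC_NonsplitWeilSixfolds[]`, `HC_AVDimLE[m]`.
* (P) ON-PATH: each target is a CASE of `HodgeConjecture` and of `HC_AV`; `HC_WeilTypeAt[n,d] ↔ split ∧ non-split`.
* (J) JOINTS WITH THE WEIL-TYPE LADDER (`Theorems/WeilTypeLadder.lean`, cell `hweil`):
  `HC_WeilType[] → WeilClassesImaginaryQuadratic` (R∞), `HC_SplitWeilType[] → SplitWeilAbelianVarieties` (R2),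
  `HC_NonsplitWeilSixfolds[] → NonsplitSixfolds` (R1′), `HC_AV → WeilClassesCMField` (R3) — a non-zero rational
  `(n,n)` class in the Weil plane FORCES Weil type (`isWeilType_of_weilClass_ne_zero`), so no Weil-type
  hypothesis is lost at the joints.
* (C) THE `HC_CM` COLUMN: `CMToAbelian → HC_CM → HC_WeilType[]` (the cell's conditional target
  `HC_WeilType_of_HC_CM` follows from the route crux) and, in the OPPOSITE direction, André 1992:
  `[André 1992] → HC_WeilType[] → WeilClassesCMField → HC_CM` — in print the Weil-type classes imply Hodge-for-CM,
  not conversely; the converse is exactly what this cell's route seats (`transport`, `deform`, `motiv`) price.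
* (B) BASE CASES: `HC_AVDimLE[3]` and `HC_WeilTypeAt[1, d]` UNCONDITIONALLY (Lefschetz (1,1) + Hard Lefschetz,
  tree theorems); `HC_AVDimLE[5]` and `HC_WeilTypeAt[2, d]` from Markman's dimension-`≤ 5` corollary
  (arXiv:2509.23403 Cor. 1.3, UNREFEREED — an explicit hypothesis, the Literature statement
  `Markman2025_hodgeClasses_algebraic_abelian_dim_le_five`). First open slices: `HC_WeilTypeAt[3, d]`
  (sixfolds: split = Markman [M] arXiv:2502.03415 Thm. 1.5.1, UNREFEREED, not yet a tree theorem; non-split = OPEN, ladder R1′).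

References: [vanGeemen1994HodgeAV] Def. 4.9, Lemma 5.2, Thm. 4.11, Thm. 4.15, Thm. 6.12 (LNM 1594; 7.3 = Schoen sixfolds, not used);
[Deligne1982HodgeCycles] Prop. 4.4, Thm. 4.8, §5 (LNM 900); [MoonenZarhin1999LowDim] Thm. 0.1;
[MoonenZarhin1998WeilClasses] §1; [Andre1992HodgeCM]; [Weil1977HodgeRing]; [Markman2025SurveySecant] Thm. 1.1,
Cor. 1.3, §11.5, §12 (UNREFEREED survey arXiv:2509.23403; proofs in [Markman2025SecantWeil] arXiv:2502.03415, UNREFEREED; the REFEREED [Markman2023GeneralizedKummers] JEMS 25 (2023) Thm. 1.3 = fourfolds, discriminant 1 only); [Milne1999] §7;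
[Deligne2000] §1. PerL / QW8 / the 2001 programme are cited nowhere.
-/

-- every declaration of this problem lives in `Summit.HodgeConjecture.HodgeConjecture.…` (summit = sub-problem);
-- the cell's own tree `Summits/HodgeConjecture/Ring2/` is not allowlisted at the gate (2026-08-19), so this file
-- lands under `Theorems/` with the namespace suffix `Ring2.WeilType`.
set_option linter.dupNamespace false

noncomputable section

namespace Summit.HodgeConjecture.HodgeConjecture.Ring2.WeilType

open CategoryTheory
open Literature.AlgebraicGeometry Literature.AlgebraicGeometry.Motives
open Literature.AlgebraicGeometry.HodgeTheory
open Literature.AlgebraicTopology.SingularHomology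
open Summit.HodgeConjecture.HodgeConjecture.WeilTypeLadder
open Summit.HodgeConjecture.HodgeConjecture.Theses.RankFourFaces (CMAbelianHodge CMToAbelian)
open Summit.HodgeConjecture.HodgeConjecture.Theses.PadicSemiregularLift (HodgeAbelianVarieties)

/-! ### (T) The class targets (local notations; bodies VERBATIM the staged `Ring2/Defs.lean` §3 with
`HCAt A := HodgeConjectureFor A.dim A.X` unfolded) -/

/-- `HC_WeilType[]` — the Hodge conjecture for every complex abelian variety of Weil type (all imaginary
quadratic `K`, all `n`); van Geemen (Thm. 4.11, 6.12): the general Weil-type member has Hodge ring generated by divisors and the Weil plane. -/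
local notation3 (prettyPrint := false) "HC_WeilType[]" =>
  ∀ (A : AbelianVariety ℂ), WeilType A → HodgeConjectureFor A.dim A.X

/-- `HC_WeilTypeAt[n, d]` — the Hodge conjecture for every abelian variety of Weil type of signature `(n,n)`
for `K = ℚ(φ)`, `φ² = -d`. -/
local notation3 (prettyPrint := false) "HC_WeilTypeAt[" n ", " d "]" =>
  ∀ (A : AbelianVariety ℂ) (φ : A ⟶ A), IsWeilType A φ n d → HodgeConjectureFor A.dim A.X

/-- `HC_SplitWeilTypeAt[n, d]` — the same for SPLIT Weil type (trivial discriminant class). -/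
local notation3 (prettyPrint := false) "HC_SplitWeilTypeAt[" n ", " d "]" =>
  ∀ (A : AbelianVariety ℂ) (φ : A ⟶ A), IsSplitWeilType A φ n d → HodgeConjectureFor A.dim A.X

/-- `HC_NonsplitWeilTypeAt[n, d]` — the same for NON-SPLIT Weil type. -/
local notation3 (prettyPrint := false) "HC_NonsplitWeilTypeAt[" n ", " d "]" =>
  ∀ (A : AbelianVariety ℂ) (φ : A ⟶ A), IsNonsplitWeilType A φ n d → HodgeConjectureFor A.dim A.X

/-- `HC_SplitWeilType[]` — split Weil type, every `(n, d)`. -/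
local notation3 (prettyPrint := false) "HC_SplitWeilType[]" =>
  ∀ (n d : ℕ) (A : AbelianVariety ℂ) (φ : A ⟶ A), IsSplitWeilType A φ n d → HodgeConjectureFor A.dim A.X

/-- `HC_NonsplitWeilSixfolds[]` — non-split Weil type, `n = 3` (sixfolds), every `d`: the first open slice. -/
local notation3 (prettyPrint := false) "HC_NonsplitWeilSixfolds[]" =>
  ∀ (d : ℕ) (A : AbelianVariety ℂ) (φ : A ⟶ A), IsNonsplitWeilType A φ 3 d → HodgeConjectureFor A.dim A.X

/-- `HC_AVDimLE[m]` — the Hodge conjecture for every complex abelian variety of dimension `≤ m`. -/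
local notation3 (prettyPrint := false) "HC_AVDimLE[" m "]" =>
  ∀ (A : AbelianVariety ℂ), A.dim ≤ m → HodgeConjectureFor A.dim A.X

/-! ### (P) On-path lemmas: every target is a CASE of the Hodge conjecture, and of `HC_AV` -/

-- ON-PATH `HodgeConjecture → HC_AV`, `HodgeConjecture → HC_CM` and the arrow `HC_AV → HC_CM` are ALREADY in
-- the tree (deform seat, `Theorems/Ring2DeformVariationalInputs.lean`): `Ring2.Deform.HC_AV_of_hodgeConjecture`,
-- `Ring2.Deform.HC_CM_of_hodgeConjecture`, `Ring2.Deform.HC_CM_of_HC_AV` — reused below by name, not restated.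

/-- ARROW: `HC_AV → HC_WeilType[]`. [cite: vanGeemen1994HodgeAV, Thm. 4.11] -/
theorem hc_weilType_of_hc_av (h : HodgeAbelianVarieties) : HC_WeilType[] :=
  fun A _ ↦ h A

/-- ON-PATH: `HodgeConjecture → HC_WeilType[]`. [cite: Deligne2000, §1] -/
theorem hc_weilType_of_hodgeConjecture (h : _root_.HodgeConjecture) : HC_WeilType[] :=
  hc_weilType_of_hc_av (Ring2.Deform.HC_AV_of_hodgeConjecture h)

/-- ARROW: `HC_WeilType[] → HC_WeilTypeAt[n, d]`. [cite: vanGeemen1994HodgeAV, Definition 4.9] -/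
theorem hc_weilTypeAt_of_hc_weilType (h : HC_WeilType[]) (n d : ℕ) : HC_WeilTypeAt[n, d] :=
  fun A φ hW ↦ h A ⟨n, d, φ, hW⟩

/-- GLUE: `HC_WeilType[] ↔ ∀ n d, HC_WeilTypeAt[n, d]`. [cite: vanGeemen1994HodgeAV, Definition 4.9] -/
theorem hc_weilType_iff_forall_at : HC_WeilType[] ↔ ∀ n d : ℕ, HC_WeilTypeAt[n, d] :=
  ⟨hc_weilTypeAt_of_hc_weilType, fun h A ⟨n, d, φ, hW⟩ ↦ h n d A φ hW⟩

/-- ON-PATH: `HodgeConjecture → HC_WeilTypeAt[n, d]`. [cite: Deligne2000, §1] -/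
theorem hc_weilTypeAt_of_hodgeConjecture (h : _root_.HodgeConjecture) (n d : ℕ) : HC_WeilTypeAt[n, d] :=
  hc_weilTypeAt_of_hc_weilType (hc_weilType_of_hodgeConjecture h) n d

/-- GLUE: `HC_WeilTypeAt[n, d] ↔ HC_SplitWeilTypeAt[n, d] ∧ HC_NonsplitWeilTypeAt[n, d]` (the discriminant
dichotomy is exhaustive: `IsWeilType.split_or_nonsplit`). [cite: vanGeemen1994HodgeAV, Lemma 5.2 (3) and 5.4] -/
theorem hc_weilTypeAt_iff_split_and_nonsplit (n d : ℕ) :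
    HC_WeilTypeAt[n, d] ↔ HC_SplitWeilTypeAt[n, d] ∧ HC_NonsplitWeilTypeAt[n, d] :=
  ⟨fun h ↦ ⟨fun A φ hW ↦ h A φ hW.isWeilType, fun A φ hW ↦ h A φ hW.isWeilType⟩,
    fun ⟨hs, hns⟩ A φ hW ↦ (hW.split_or_nonsplit).elim (hs A φ) (hns A φ)⟩

/-- ON-PATH: `HodgeConjecture → HC_SplitWeilType[]`. [cite: Deligne2000, §1] -/
theorem hc_splitWeilType_of_hodgeConjecture (h : _root_.HodgeConjecture) : HC_SplitWeilType[] :=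
  fun n d A φ hW ↦ hc_weilTypeAt_of_hodgeConjecture h n d A φ hW.isWeilType

/-- ARROW: `HC_WeilType[] → HC_SplitWeilType[]`. [cite: vanGeemen1994HodgeAV, 5.4] -/
theorem hc_splitWeilType_of_hc_weilType (h : HC_WeilType[]) : HC_SplitWeilType[] :=
  fun n d A φ hW ↦ hc_weilTypeAt_of_hc_weilType h n d A φ hW.isWeilType

/-- ON-PATH: `HodgeConjecture → HC_NonsplitWeilSixfolds[]`. [cite: Deligne2000, §1] -/
theorem hc_nonsplitWeilSixfolds_of_hodgeConjecture (h : _root_.HodgeConjecture) : HC_NonsplitWeilSixfolds[] :=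
  fun d A φ hW ↦ hc_weilTypeAt_of_hodgeConjecture h 3 d A φ hW.isWeilType

/-- ARROW: `HC_WeilType[] → HC_NonsplitWeilSixfolds[]`. [cite: Markman2025SurveySecant, §11.5 Step 1] -/
theorem hc_nonsplitWeilSixfolds_of_hc_weilType (h : HC_WeilType[]) : HC_NonsplitWeilSixfolds[] :=
  fun d A φ hW ↦ hc_weilTypeAt_of_hc_weilType h 3 d A φ hW.isWeilType

/-- ON-PATH: `HodgeConjecture → HC_AVDimLE[m]`. [cite: Deligne2000, §1] -/
theorem hc_avDimLE_of_hodgeConjecture (h : _root_.HodgeConjecture) (m : ℕ) : HC_AVDimLE[m] :=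
  fun A _ ↦ Ring2.Deform.HC_AV_of_hodgeConjecture h A

/-- ARROW: `HC_AV → HC_AVDimLE[m]`. [cite: Deligne2000, §1] -/
theorem hc_avDimLE_of_hc_av (h : HodgeAbelianVarieties) (m : ℕ) : HC_AVDimLE[m] :=
  fun A _ ↦ h A

/-! ### (J) Joints with the Weil-type ladder (`Theorems/WeilTypeLadder.lean`, cell `hweil`) -/

/-- **The `(n, d)`-slice of the ladder's R∞ from `HC_WeilTypeAt[n, d]`** (`n ≥ 1`, `d ≥ 1`): for `A` of
dimension `2n` with `φ² = -d`, every RATIONAL class of Hodge type `(n,n)` in the Weil plane is algebraic — with NO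
Weil-type hypothesis: a non-zero such class forces Weil type (`isWeilType_of_weilClass_ne_zero`, Deligne's
Prop. 4.4 ⇒) and `0` is algebraic. [cite: Deligne1982HodgeCycles, §4 Prop. 4.4] [cite: Weil1977HodgeRing] -/
theorem weilClasses_algebraic_of_hc_weilTypeAt {n d : ℕ} (h : HC_WeilTypeAt[n, d]) (hn : 0 < n) (hd : 0 < d)
    (A : AbelianVariety ℂ) (φ : A ⟶ A) (hA : A.dim = 2 * n) (hφ : φ ≫ φ = -(d • 𝟙 A))
    (c : complexBetti A.X (2 * n)) (hc : IsRationalClass c) (hnn : IsOfHodgeType (2 * n) A.X (2 * n) n n c)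
    (hW : c ∈ weilClassesOf A φ n d) : c ∈ algebraicClasses A.X n := by
  by_cases hc0 : c = 0
  · rw [hc0]
    exact Submodule.zero_mem _
  · have hWT : IsWeilType A φ n d := isWeilType_of_weilClass_ne_zero hn hd hA hφ hW hc0 hnn
    have hHC : HodgeConjectureFor A.dim A.X := h A φ hWT
    rw [hA] at hHC
    exact hHC.2 n c hc hnn

/-- **JOINT: `HC_WeilType[] → WeilClassesImaginaryQuadratic` (ladder R∞)**, hence (by
`Theorems/WeilTypeLadderOnPath`) R2 `SplitWeilAbelianVarieties`, R2₈ `SplitEightfolds`, R1 `WeilSixfolds`,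
R1′ `NonsplitSixfolds`. [cite: Weil1977HodgeRing] [cite: Markman2025SurveySecant, §12] -/
theorem weilClassesImaginaryQuadratic_of_hc_weilType (h : HC_WeilType[]) : WeilClassesImaginaryQuadratic :=
  fun n hn d hd A φ hA _ hφ c hc hnn hW ↦
    weilClasses_algebraic_of_hc_weilTypeAt (hc_weilTypeAt_of_hc_weilType h n d) (by omega) hd A φ hA hφ c hc
      hnn hW

/-- **JOINT: `HC_SplitWeilType[] → SplitWeilAbelianVarieties` (ladder R2)** (the rung's inline hypotheses say
exactly `IsSplitWeilType` once the class is non-zero). [cite: Markman2025SurveySecant, §12]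
[cite: Deligne1982HodgeCycles, §4 Prop. 4.4] -/
theorem splitWeilAbelianVarieties_of_hc_splitWeilType (h : HC_SplitWeilType[]) : SplitWeilAbelianVarieties := by
  intro n hn d hd A φ hA _ hφ e a ha ha0 hhyp c hc hnn hW
  by_cases hc0 : c = 0
  · rw [hc0]
    exact Submodule.zero_mem _
  · have hWT : IsWeilType A φ n d := isWeilType_of_weilClass_ne_zero (by omega) hd hA hφ hW hc0 hnn
    have hHC : HodgeConjectureFor A.dim A.X := h n d A φ ⟨hWT, e, a, ha, ha0, hhyp⟩
    rw [hA] at hHC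
    exact hHC.2 n c hc hnn

/-- **JOINT: `HC_NonsplitWeilSixfolds[] → NonsplitSixfolds` (ladder R1′, the first open non-split rung).**
[cite: Markman2025SurveySecant, §11.5 Step 1] [cite: Deligne1982HodgeCycles, §4 Prop. 4.4] -/
theorem nonsplitSixfolds_of_hc_nonsplitWeilSixfolds (h : HC_NonsplitWeilSixfolds[]) : NonsplitSixfolds := by
  intro d hd A φ hA _ hφ hns c hc h33 hW
  by_cases hc0 : c = 0
  · rw [hc0]
    exact Submodule.zero_mem _
  · have hWT : IsWeilType A φ 3 d := isWeilType_of_weilClass_ne_zero (by norm_num) hd hA hφ hW hc0 h33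
    have hHC : HodgeConjectureFor A.dim A.X := h d A φ ⟨hWT, hns⟩
    rw [hA] at hHC
    exact hHC.2 3 c hc h33

/-- **JOINT: `HC_AV → WeilClassesCMField` (ladder R3, CM fields `K` of degree `> 2`)** — the general-Weil-type
classes are reached by this cell only through `HC_AV` (no `IsWeilType` for `[K:ℚ] > 2` is typed; the ladder's
inline carrier does it). [cite: MoonenZarhin1998WeilClasses, §1] [cite: Markman2025SurveySecant, §12] -/
theorem weilClassesCMField_of_hc_av (h : HodgeAbelianVarieties) : WeilClassesCMField :=
  fun A _ _ _ m _ _ _ _ _ _ _ _ c _ hc hmm ↦ (h A).2 m c hc hmm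

/-! ### (C) The `HC_CM` column: which way the implications run -/

/-- **`CMToAbelian → HC_CM → HC_WeilType[]`**: the cell's conditional target `HC_WeilType_of_HC_CM` follows from
the open route crux `RankFourFaces.CMToAbelian` (stmt-HodgeConjecture-16267) — `HC_CM` a hypothesis.
[cite: Deligne1982HodgeCycles, Prop. 6.1] -/
theorem hc_weilType_of_cmToAbelian_of_hc_cm (h : CMToAbelian) (hCM : CMAbelianHodge) : HC_WeilType[] :=
  fun A _ ↦ h hCM A (AbelianVariety.isSmoothProjective_holds (A := A))

/-- **`CMToAbelian → HC_CM → R∞`** (the ladder's whole imaginary-quadratic column under `HC_CM` + the crux).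
[cite: Markman2025SurveySecant, §12] -/
theorem weilClassesImaginaryQuadratic_of_cmToAbelian_of_hc_cm (h : CMToAbelian) (hCM : CMAbelianHodge) :
    WeilClassesImaginaryQuadratic :=
  weilClassesImaginaryQuadratic_of_hc_weilType (hc_weilType_of_cmToAbelian_of_hc_cm h hCM)

/-- **The direction that IS in print — André 1992: Weil type ⇒ CM.** Granted André's theorem (every Hodge class
on a CM abelian variety lies in the span of pull-backs of Weil classes from abelian varieties of split Weil
type; Literature statement `Andre1992_…`, a THEOREM in print, untyped proof), `HC_WeilType[]` together with the
ladder's CM-field rung R3 PROVES `HC_CM` (tree: `WeilTypeLadder.rankFourFaces_cmAbelianHodge_of_andre_of_rungs`).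
So `HC_CM ⇒ HC_WeilType[]` — this cell's target — is the CONVERSE of the printed implication.
[cite: Andre1992HodgeCM] [cite: vanGeemen1994HodgeAV, Thm. 4.11] -/
theorem hc_cm_of_andre_of_hc_weilType_of_weilClassesCMField
    (hA : Andre1992_hodgeClasses_cmAbelianVariety_mem_span_pullback_weilClasses) (h : HC_WeilType[])
    (h₃ : WeilClassesCMField) : CMAbelianHodge :=
  rankFourFaces_cmAbelianHodge_of_andre_of_rungs hA (weilClassesImaginaryQuadratic_of_hc_weilType h) h₃

/-! ### (B) Base cases: where the targets are already THEOREMS -/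

/-- **`HC_AVDimLE[3]` UNCONDITIONALLY**: the Hodge conjecture for complex abelian varieties of dimension `≤ 3`
(Lefschetz (1,1) + Hard Lefschetz duality; tree theorem `hodgeConjectureFor_of_dim_le_three_holds`).
[cite: VoisinHodgeII2003, Thm. 11.30 and Rem. 11.31] -/
theorem hc_avDimLE_three : HC_AVDimLE[3] :=
  fun A hd ↦ hodgeConjectureFor_of_dim_le_three_holds hd (AbelianVariety.isSmoothProjective_holds (A := A))

/-- **`HC_WeilTypeAt[1, d]` UNCONDITIONALLY** (Weil-type abelian SURFACES: `dim A = 2 ≤ 3`).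
[cite: VoisinHodgeII2003, Thm. 11.30] [cite: vanGeemen1994HodgeAV, Definition 4.9] -/
theorem hc_weilTypeAt_one (d : ℕ) : HC_WeilTypeAt[1, d] :=
  fun A _ hW ↦ hc_avDimLE_three A (by have := hW.dim_eq; omega)

/-- **`HC_AVDimLE[5]` from Markman's dimension-`≤ 5` corollary** (arXiv:2509.23403 Cor. 1.3, UNREFEREED; an
explicit hypothesis — the Literature statement, not a fact). [cite: Markman2025SurveySecant, Cor. 1.3]
[cite: MoonenZarhin1999LowDim, Thm. 0.1] -/
theorem hc_avDimLE_five_of (h : Markman2025_hodgeClasses_algebraic_abelian_dim_le_five) : HC_AVDimLE[5] :=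
  fun A hd ↦ hodgeConjectureFor_abelian_of_dim_le_five_of h A nonempty_hodgeModel_holds hd
    (AbelianVariety.isSmoothProjective_holds (A := A))

/-- **`HC_WeilTypeAt[2, d]` (Weil-type FOURFOLDS) from Markman's dimension-`≤ 5` corollary** (UNREFEREED
hypothesis; the REFEREED [J] JEMS 25 (2023) Thm. 1.3 covers `n = 2`, discriminant 1 only; all discriminants for `n = 2` is [M] arXiv:2502.03415 Cor. 1.6.1, UNREFEREED; neither is a tree
theorem). [cite: Markman2023GeneralizedKummers, Thm. 1.3] [cite: Markman2025SecantWeil, Cor. 1.6.1] [cite: Markman2025SurveySecant, Cor. 1.3] -/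
theorem hc_weilTypeAt_two_of (h : Markman2025_hodgeClasses_algebraic_abelian_dim_le_five) (d : ℕ) :
    HC_WeilTypeAt[2, d] :=
  fun A _ hW ↦ hc_avDimLE_five_of h A (by have := hW.dim_eq; omega)

/-- Summary of the on-path direction: every hypothesis and every target of this file is a consequence of the
Hodge conjecture. [cite: Deligne2000, §1] -/
theorem targets_of_hodgeConjecture (h : _root_.HodgeConjecture) :
    HodgeAbelianVarieties ∧ CMAbelianHodge ∧ HC_WeilType[] ∧ HC_SplitWeilType[] ∧ HC_NonsplitWeilSixfolds[] ∧
      WeilClassesImaginaryQuadratic ∧ WeilClassesCMField :=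
  ⟨Ring2.Deform.HC_AV_of_hodgeConjecture h, Ring2.Deform.HC_CM_of_hodgeConjecture h, hc_weilType_of_hodgeConjecture h,
    hc_splitWeilType_of_hodgeConjecture h, hc_nonsplitWeilSixfolds_of_hodgeConjecture h,
    weilClassesImaginaryQuadratic_of_hc_weilType (hc_weilType_of_hodgeConjecture h),
    weilClassesCMField_of_hc_av (Ring2.Deform.HC_AV_of_hodgeConjecture h)⟩

end Summit.HodgeConjecture.HodgeConjecture.Ring2.WeilType
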